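import Literature.NumberTheory.ConnesConsani2021.ArchKernelTier2Panels
import Literature.NumberTheory.ConnesConsani2021.ArchKernelModesMISound
import Literature.Analysis.ValidatedNumerics.TaylorModelLinComb
import Literature.Analysis.SpecialFunctions.BetaIntegralPanel
import HarnessLib

/-!
# (E-a) Tier 2 — (B2) COMBINE-SOUNDNESS: the contracted data `combinedLit` encloses the real mode sums

RH-FREE (label, line 1).  bears_on (cell rh-crit, corpus C1): route «ConnesConsaniSemilocal» item K3 `WindowSpectralBound`
(stmt 19306) — cc-lead R127/R128 piece (B2), seat rh-crit-cc-eng-1 g2 (engine).  Seat cc-iso g4's LANDED data module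
`ArchKernelTier2Panels.lean` (p447146) contracts the eight K1 modes into `combinedLit = ⟨Kin, Kout, C, cFs, cFu, W⟩`
(`combine_eq : combine modes truncOrders = some combinedLit`, kernel).  This file proves, for ANY reals `b n` in the
K1 brackets and `t n` in the K1 `t`-intervals (`n < 8`; the consumers take them from gm-t16's
`ArchCert.mode_package_of_mem_modes`), that the entries of `combinedLit.C`, `.cFs`, `.cFu` ENCLOSE the real numbers
`C_ij = Σ_{n<8} t_n·g_i^{(n)}·f_j^{(n)}·β(i,j)`, `cFs_j = Σ_n t_n f_j^{(n)}`, `cFu_i = Σ_n t_n f_i^{(n)}` with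
`f_j^{(n)} = (j+1)·a_{j+1}(b_n)` (`a_k = frobCoeff 1 (b n) k`, truncated to `j < Kout(n)` = 34/30 as in `truncOrders`),
`g_i = f_i − 2f_{i−1} + f_{i−2}`, `β(i,j) = i!j!/(i+j+1)!`.  METHOD: a direct symbolic twin `Csym/cFsSym/cFuSym` of the
relevant entries (same interval operations and association as `combine`'s folds, so the SAME integers), whose agreement
with the literal `combinedLit` is ONE kernel evaluation (`combineSymCheck_eq_true`), and generic `MI.mem` lemmas
(`mem_sumMI`, `mem_mul`, gm-t16's `mem_frobCoeffMI`, t12's Beta recurrence `beta_factorial_succ_right`).  The analytic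
identity turning these numbers into `S₈` (B1) and the truncation allowance `W` are NOT here (t4 g4 / cc-iso g4).
Nothing here mentions ζ or RH; nothing here bears on the truth of RH.
-/

namespace Literature.NumberTheory.ConnesConsani2021.ArchCertT2

open Literature.Analysis.ValidatedNumerics Literature.Analysis.ValidatedNumerics.NumericsMP
  Literature.Analysis.ValidatedNumerics.PolyMP Literature.NumberTheory.LFunctions
  Literature.NumberTheory.ConnesConsani2021.ArchCert Finset
open scoped Nat

/-! ## The symbolic twin of the contracted entries -/

/-- Default mode datum (never used: all indices below are `< 8`). [cite: ConnesConsani2021, Prop. 5.3 p. 32 (in-kernel (E-a) certificate)] -/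
def dflt : ModeData := ⟨0, 0, 0, false, ⟨0, 0, 0, 0⟩⟩
/-- The `n`-th K1 mode. [cite: ConnesConsani2021, Prop. 5.3 p. 32 (in-kernel (E-a) certificate)] -/
def md (n : ℕ) : ModeData := modes.getD n dflt
/-- `Kout(n)` of `truncOrders`. [cite: ConnesConsani2021, Prop. 5.3 p. 32 (in-kernel (E-a) certificate)] -/
def koutOf (n : ℕ) : ℕ := (truncOrders.getD n (0, 0)).2
/-- The `t`-interval of mode `n` (`modeQuantities`, `getD`). [cite: ConnesConsani2021, Lemma 5.4 p. 33 (in-kernel (E-a) certificate)] -/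
def tI (n : ℕ) : MI := ((modeQuantities (md n)).map fun q ↦ q.2.2.2).getD zeroI
/-- `f_j^{(n)} ∋ (j+1)·a_{j+1}`. [cite: ConnesConsani2021, Prop. 5.3 p. 32 (in-kernel (E-a) certificate)] -/
def fI (n j : ℕ) : MI := (frobCoeffMI (md n).chi (j + 1)).mulInt ((j : ℤ) + 1)
/-- `g_i^{(n)} = f_i − 2f_{i−1} + f_{i−2}` (same association as `combine`). [cite: ConnesConsani2021, Prop. 5.3 p. 32 (in-kernel (E-a) certificate)] -/
def gI (n i : ℕ) : MI :=
  ((fI n i).sub ((if i = 0 then zeroI else fI n (i - 1)).mulInt 2)).add (if i < 2 then zeroI else fI n (i - 2))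
/-- `β(i,j)` by the recurrence `β(i,0) = 1/(i+1)`, `β(i,j+1) = β(i,j)(j+1)/(i+j+2)` (as `betaRow`). [cite: ConnesConsani2021, Prop. 5.3 p. 32 (Beta form of the panel integral)] -/
def betaI (i : ℕ) : ℕ → MI
  | 0 => MI.ofFrac S 1 (i + 1)
  | j + 1 => ((betaI i j).mulInt ((j : ℤ) + 1)).divNat (i + j + 2)
/-- The symbolic `C_{ij}` (same products/association as `combine`: `((t·g)·f)·β`, zero beyond `Kout(n)`). [cite: ConnesConsani2021, Prop. 5.3 p. 32 (in-kernel (E-a) certificate)] -/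
def Csym (i j : ℕ) : MI :=
  PolyMP.sumMI S ((List.range 8).map fun n ↦
    if j < koutOf n then mulMI (mulMI (mulMI (tI n) (gI n i)) (fI n j)) (betaI i j) else zeroI)
/-- The symbolic `cFs_j = Σ_n t_n f_j^{(n)}`. [cite: ConnesConsani2021, Prop. 5.3 p. 32 (in-kernel (E-a) certificate)] -/
def cFsSym (j : ℕ) : MI := PolyMP.sumMI S ((List.range 8).map fun n ↦ if j < koutOf n then mulMI (tI n) (fI n j) else zeroI)
/-- The symbolic `cFu_i = Σ_n t_n f_i^{(n)}` (`i < 24`). [cite: ConnesConsani2021, Prop. 5.3 p. 32 (in-kernel (E-a) certificate)] -/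
def cFuSym (i : ℕ) : MI := PolyMP.sumMI S ((List.range 8).map fun n ↦ mulMI (tI n) (fI n i))
/-- Entry `(i,j)` of `combinedLit.C`. [cite: ConnesConsani2021, Prop. 5.3 p. 32 (in-kernel (E-a) certificate)] -/
def Clit (i j : ℕ) : MI := (combinedLit.C.getD i []).getD j zeroI

/-- The twin agrees with the literal: all `24 × 34` entries of `C`, the 34 of `cFs`, the 24 of `cFu`, and
`(Kin, Kout) = (24, 34)`. [cite: ConnesConsani2021, Prop. 5.3 p. 32 (in-kernel (E-a) certificate)] -/
def combineSymCheck : Bool :=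
  decide (combinedLit.Kin = 24) && decide (combinedLit.Kout = 34) &&
  ((List.range 24).all fun i ↦ (List.range 34).all fun j ↦ decide (Csym i j = Clit i j)) &&
  ((List.range 34).all fun j ↦ decide (cFsSym j = combinedLit.cFs.getD j zeroI)) &&
  ((List.range 24).all fun i ↦ decide (cFuSym i = combinedLit.cFu.getD i zeroI))

set_option maxRecDepth 20000 in
/-- **Kernel evaluation** of the twin check. [cite: ConnesConsani2021, Prop. 5.3 p. 32 (in-kernel (E-a) certificate)] -/
theorem combineSymCheck_eq_true : combineSymCheck = true := by
  decide +kernel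

/-! ## Unpacking the twin check -/

/-- `Csym = Clit` on `24 × 34`. [cite: ConnesConsani2021, Prop. 5.3 eqs. (97)–(99) §5 p. 32; §6.3–6.4 p. 24 (in-kernel (E-a) certificate)] -/
theorem csym_eq_clit {i j : ℕ} (hi : i < 24) (hj : j < 34) : Csym i j = Clit i j := by
  have h := combineSymCheck_eq_true
  simp only [combineSymCheck, Bool.and_eq_true, List.all_eq_true, List.mem_range, decide_eq_true_eq] at h
  exact h.1.1.2 i hi j hj

/-- `cFsSym = combinedLit.cFs`. [cite: ConnesConsani2021, Prop. 5.3 eqs. (97)–(99) §5 p. 32; §6.3–6.4 p. 24 (in-kernel (E-a) certificate)] -/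
theorem cFsSym_eq {j : ℕ} (hj : j < 34) : cFsSym j = combinedLit.cFs.getD j zeroI := by
  have h := combineSymCheck_eq_true
  simp only [combineSymCheck, Bool.and_eq_true, List.all_eq_true, List.mem_range, decide_eq_true_eq] at h
  exact h.1.2 j hj

/-- `cFuSym = combinedLit.cFu`. [cite: ConnesConsani2021, Prop. 5.3 eqs. (97)–(99) §5 p. 32; §6.3–6.4 p. 24 (in-kernel (E-a) certificate)] -/
theorem cFuSym_eq {i : ℕ} (hi : i < 24) : cFuSym i = combinedLit.cFu.getD i zeroI := by
  have h := combineSymCheck_eq_true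
  simp only [combineSymCheck, Bool.and_eq_true, List.all_eq_true, List.mem_range, decide_eq_true_eq] at h
  exact h.2 i hi

/-- `(Kin, Kout) = (24, 34)`. [cite: ConnesConsani2021, Prop. 5.3 eqs. (97)–(99) §5 p. 32; §6.3–6.4 p. 24 (in-kernel (E-a) certificate)] -/
theorem kin_kout_eq : combinedLit.Kin = 24 ∧ combinedLit.Kout = 34 := by
  have h := combineSymCheck_eq_true
  simp only [combineSymCheck, Bool.and_eq_true, List.all_eq_true, List.mem_range, decide_eq_true_eq] at h
  exact ⟨h.1.1.1.1, h.1.1.1.2⟩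

/-! ## Membership of the real data -/

/-- `0 ∈ zeroI`. [cite: ConnesConsani2021, Prop. 5.3 eqs. (97)–(99) §5 p. 32; §6.3–6.4 p. 24 (in-kernel (E-a) certificate)] -/
theorem mem_zeroI : MI.mem S (0 : ℝ) zeroI := by
  simpa [zeroI] using MI.mem_ofInt S 0

/-- `md n ∈ modes` for `n < 8`. [cite: ConnesConsani2021, Prop. 5.3 eqs. (97)–(99) §5 p. 32; §6.3–6.4 p. 24 (in-kernel (E-a) certificate)] -/
theorem md_mem {n : ℕ} (hn : n < 8) : md n ∈ modes := by
  unfold md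
  interval_cases n <;> decide

/-- A real `t n` certified by K1's `modeQuantities` lies in `tI n`. [cite: ConnesConsani2021, Prop. 5.3 eqs. (97)–(99) §5 p. 32; §6.3–6.4 p. 24 (in-kernel (E-a) certificate)] -/
theorem mem_tI {t : ℕ → ℝ} {n : ℕ} (hn : n < 8)
    (ht : ∀ q, modeQuantities (md n) = some q → MI.mem S (t n) q.2.2.2) : MI.mem S (t n) (tI n) := by
  obtain ⟨q, hq⟩ := modeQuantities_isSome_of_mem_modes (md_mem hn)
  have h := ht q hq
  simpa [tI, hq] using h

/-- The Frobenius datum `f_j^{(n)} = (j+1)·a_{j+1}(b_n)` of a real `b_n` in the `n`-th bracket lies in `fI n j`. [cite: ConnesConsani2021, Prop. 5.3 eqs. (97)–(99) §5 p. 32; §6.3–6.4 p. 24 (in-kernel (E-a) certificate)] -/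
theorem mem_fI {b : ℕ → ℝ} {n : ℕ} (hb : MI.mem S (b n) (md n).chi) (j : ℕ) :
    MI.mem S (frobCoeff 1 (b n) (j + 1) * ((j : ℝ) + 1)) (fI n j) := by
  have h := MI.mem_mulInt (mem_frobCoeffMI hb (j + 1)) ((j : ℤ) + 1)
  simpa [fI] using h

/-- `β(i,j) = i!j!/(i+j+1)! ∈ betaI i j`. [cite: ConnesConsani2021, Prop. 5.3 eqs. (97)–(99) §5 p. 32; §6.3–6.4 p. 24 (in-kernel (E-a) certificate)] -/
theorem mem_betaI (i : ℕ) : ∀ j : ℕ, MI.mem S ((i ! * j ! : ℝ) / (i + j + 1)!) (betaI i j)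
  | 0 => by
    have h := MI.mem_ofFrac S 1 (q := i + 1) (by omega)
    rw [Literature.Analysis.SpecialFunctions.beta_factorial_zero_right]
    simpa [betaI] using h
  | j + 1 => by
    have ih := mem_betaI i j
    have h := MI.mem_divNat (MI.mem_mulInt ih ((j : ℤ) + 1)) (n := i + j + 2) (by omega)
    rw [Literature.Analysis.SpecialFunctions.beta_factorial_succ_right]
    simp only [betaI]
    convert h using 1
    push_cast
    ring

/-- Sum of eight enclosed reals. [cite: ConnesConsani2021, Prop. 5.3 eqs. (97)–(99) §5 p. 32; §6.3–6.4 p. 24 (in-kernel (E-a) certificate)] -/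
theorem mem_sumMI_range8 {F : ℕ → MI} {x : ℕ → ℝ} (hx : ∀ n < 8, MI.mem S (x n) (F n)) :
    MI.mem S (∑ n ∈ range 8, x n) (PolyMP.sumMI S ((List.range 8).map F)) := by
  have h := PolyMP.mem_sumMI (S := S) (l := (List.range 8).map F) (x := x) (fun i hi ↦ by
    simp only [List.length_map, List.length_range] at hi
    simpa using hx i hi)
  simpa using h

/-! ## The three enclosures (for arbitrary certified families `t`, `f`, and `g_i = f_i − 2f_{i−1} + f_{i−2}`) -/

section Families

variable {t : ℕ → ℝ} {f g : ℕ → ℕ → ℝ}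

/-- **`C_{ij} ∈ combinedLit.C[i][j]`**: for `i < 24`, `j < 34`, any reals `t n ∈ tI n`, `f n j ∈ fI n j` for `j < Kout(n)`
and `f n j = 0` for `Kout(n) ≤ j`, `g n i = f n i − 2f n (i−1) + f n (i−2)` (`f n (−1) = f n (−2) = 0`):
`Σ_{n<8} t n · g n i · f n j · β(i,j) ∈ (combinedLit.C[i])[j]`. [cite: ConnesConsani2021, Prop. 5.3 eqs. (97)–(99) §5 p. 32; §6.3–6.4 p. 24 (in-kernel (E-a) certificate)] -/
theorem mem_combinedLit_C (ht : ∀ n < 8, MI.mem S (t n) (tI n))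
    (hf : ∀ n < 8, ∀ j, j < koutOf n → MI.mem S (f n j) (fI n j))
    (hf0 : ∀ n < 8, ∀ j, koutOf n ≤ j → f n j = 0)
    (hg : ∀ n i, g n i = f n i - 2 * (if i = 0 then 0 else f n (i - 1)) + (if i < 2 then 0 else f n (i - 2)))
    {i j : ℕ} (hi : i < 24) (hj : j < 34) :
    MI.mem S (∑ n ∈ range 8, t n * g n i * f n j * ((i ! * j ! : ℝ) / (i + j + 1)!)) (Clit i j) := by
  rw [← csym_eq_clit hi hj]
  unfold Csym
  have hsum : ∑ n ∈ range 8, t n * g n i * f n j * ((i ! * j ! : ℝ) / (i + j + 1)!)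
      = ∑ n ∈ range 8, (if j < koutOf n then t n * g n i * f n j * ((i ! * j ! : ℝ) / (i + j + 1)!) else 0) := by
    refine Finset.sum_congr rfl fun n hn ↦ ?_
    split_ifs with hjn
    · rfl
    · rw [hf0 n (Finset.mem_range.1 hn) j (not_lt.1 hjn)]; ring
  rw [hsum]
  refine mem_sumMI_range8 fun n hn ↦ ?_
  have hik : ∀ k, k < 24 → k < koutOf n := by
    intro k hk; unfold koutOf truncOrders; interval_cases n <;> simp <;> omega
  split_ifs with hjn
  · have hgi : MI.mem S (g n i) (gI n i) := by
      rw [hg n i]; unfold gI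
      refine MI.mem_add (MI.mem_sub (hf n hn i (hik i hi)) ?_) ?_
      · have hx : MI.mem S (if i = 0 then (0:ℝ) else f n (i - 1)) (if i = 0 then zeroI else fI n (i - 1)) := by
          split_ifs with h0
          · exact mem_zeroI
          · exact hf n hn (i - 1) (hik (i - 1) (by omega))
        simpa [mul_comm] using MI.mem_mulInt hx 2
      · split_ifs with h2
        · exact mem_zeroI
        · exact hf n hn (i - 2) (hik (i - 2) (by omega))
    exact MI.mem_mul S_pos (MI.mem_mul S_pos (MI.mem_mul S_pos (ht n hn) hgi) (hf n hn j hjn)) (mem_betaI i j)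
  · exact mem_zeroI

/-- **`cFs_j ∈ combinedLit.cFs[j]`** (`j < 34`). [cite: ConnesConsani2021, Prop. 5.3 eqs. (97)–(99) §5 p. 32; §6.3–6.4 p. 24 (in-kernel (E-a) certificate)] -/
theorem mem_combinedLit_cFs (ht : ∀ n < 8, MI.mem S (t n) (tI n))
    (hf : ∀ n < 8, ∀ j, j < koutOf n → MI.mem S (f n j) (fI n j))
    (hf0 : ∀ n < 8, ∀ j, koutOf n ≤ j → f n j = 0) {j : ℕ} (hj : j < 34) :
    MI.mem S (∑ n ∈ range 8, t n * f n j) (combinedLit.cFs.getD j zeroI) := by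
  rw [← cFsSym_eq hj]
  unfold cFsSym
  have hsum : ∑ n ∈ range 8, t n * f n j = ∑ n ∈ range 8, (if j < koutOf n then t n * f n j else 0) := by
    refine Finset.sum_congr rfl fun n hn ↦ ?_
    split_ifs with hjn
    · rfl
    · rw [hf0 n (Finset.mem_range.1 hn) j (not_lt.1 hjn)]; ring
  rw [hsum]
  refine mem_sumMI_range8 fun n hn ↦ ?_
  split_ifs with hjn
  · exact MI.mem_mul S_pos (ht n hn) (hf n hn j hjn)
  · exact mem_zeroI

/-- **`cFu_i ∈ combinedLit.cFu[i]`** (`i < 24`; every `Kout(n) ≥ 30 > i`). [cite: ConnesConsani2021, Prop. 5.3 eqs. (97)–(99) §5 p. 32; §6.3–6.4 p. 24 (in-kernel (E-a) certificate)] -/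
theorem mem_combinedLit_cFu (ht : ∀ n < 8, MI.mem S (t n) (tI n))
    (hf : ∀ n < 8, ∀ j, j < koutOf n → MI.mem S (f n j) (fI n j)) {i : ℕ} (hi : i < 24) :
    MI.mem S (∑ n ∈ range 8, t n * f n i) (combinedLit.cFu.getD i zeroI) := by
  rw [← cFuSym_eq hi]
  unfold cFuSym
  refine mem_sumMI_range8 fun n hn ↦ ?_
  have hik : i < koutOf n := by unfold koutOf truncOrders; interval_cases n <;> simp <;> omega
  exact MI.mem_mul S_pos (ht n hn) (hf n hn i hik)

end Families

/-! ## The standard instantiation from the K1 package: `t n` certified by `modeQuantities`, `f` from the brackets -/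

/-- The truncated Frobenius family: `f n j = (j+1)·a_{j+1}(b n)` for `j < Kout(n)`, else `0`. [cite: ConnesConsani2021, Prop. 5.3 eqs. (97)–(99) §5 p. 32; §6.3–6.4 p. 24 (in-kernel (E-a) certificate)] -/
noncomputable def fStd (b : ℕ → ℝ) (n j : ℕ) : ℝ :=
  if j < koutOf n then frobCoeff 1 (b n) (j + 1) * ((j : ℝ) + 1) else 0
/-- `g n i = f n i − 2f n (i−1) + f n (i−2)`. [cite: ConnesConsani2021, Prop. 5.3 eqs. (97)–(99) §5 p. 32; §6.3–6.4 p. 24 (in-kernel (E-a) certificate)] -/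
noncomputable def gStd (b : ℕ → ℝ) (n i : ℕ) : ℝ :=
  fStd b n i - 2 * (if i = 0 then 0 else fStd b n (i - 1)) + (if i < 2 then 0 else fStd b n (i - 2))

/-- `fStd` satisfies the hypotheses `hf`, `hf0`. [cite: ConnesConsani2021, Prop. 5.3 eqs. (97)–(99) §5 p. 32; §6.3–6.4 p. 24 (in-kernel (E-a) certificate)] -/
theorem fStd_mem {b : ℕ → ℝ} (hb : ∀ n < 8, MI.mem S (b n) (md n).chi) :
    (∀ n < 8, ∀ j, j < koutOf n → MI.mem S (fStd b n j) (fI n j)) ∧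
      (∀ n < 8, ∀ j, koutOf n ≤ j → fStd b n j = 0) := by
  refine ⟨fun n hn j hj ↦ ?_, fun n _ j hj ↦ ?_⟩
  · simp only [fStd, hj, if_true]; exact mem_fI (hb n hn) j
  · simp only [fStd, not_lt.2 hj, if_false]

/-- **(B2) for the K1 package**: with `b n` in the `n`-th bracket and `t n` certified by `modeQuantities (md n)`,
the three enclosures hold for `fStd b`, `gStd b`. [cite: ConnesConsani2021, Prop. 5.3 eqs. (97)–(99) §5 p. 32; §6.3–6.4 p. 24 (in-kernel (E-a) certificate)] -/
theorem combinedLit_encloses {b t : ℕ → ℝ} (hb : ∀ n < 8, MI.mem S (b n) (md n).chi)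
    (ht : ∀ n < 8, ∀ q, modeQuantities (md n) = some q → MI.mem S (t n) q.2.2.2) :
    (∀ i < 24, ∀ j < 34,
      MI.mem S (∑ n ∈ range 8, t n * gStd b n i * fStd b n j * ((i ! * j ! : ℝ) / (i + j + 1)!)) (Clit i j)) ∧
    (∀ j < 34, MI.mem S (∑ n ∈ range 8, t n * fStd b n j) (combinedLit.cFs.getD j zeroI)) ∧
    (∀ i < 24, MI.mem S (∑ n ∈ range 8, t n * fStd b n i) (combinedLit.cFu.getD i zeroI)) := by
  have ht' : ∀ n < 8, MI.mem S (t n) (tI n) := fun n hn ↦ mem_tI hn (ht n hn)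
  obtain ⟨hf, hf0⟩ := fStd_mem hb
  exact ⟨fun i hi j hj ↦ mem_combinedLit_C ht' hf hf0 (fun n i ↦ rfl) hi hj,
    fun j hj ↦ mem_combinedLit_cFs ht' hf hf0 hj, fun i hi ↦ mem_combinedLit_cFu ht' hf hi⟩

end Literature.NumberTheory.ConnesConsani2021.ArchCertT2
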